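import Summits.CriticalPhenomena.PercolationContinuityZ3.Theorems.SoloBlindPeriodicFinLadder
import HarnessLib

/-!
# Fins attached along a periodic set of feet, V: every root, and no infinite cluster at all

`SoloBlindPeriodicFinRate.periodicFin_of_lineRate` / `SoloBlindPeriodicFinLadder.finPeriods` state
`θ_{ℤ³[S_M]}(p_c(ℤ³)) = 0` at the ORIGIN of the periodic-fin region
`S_M = {0 ≤ x₀} ∪ {x₁ = 0, x₀ ≤ -2} ∪ {x₁ = 0, x₀ = -1, M ∣ x₂}`.  Here the statement is upgraded to
EVERY root, i.e. to "`ℤ³[S_M]` carries no infinite open cluster at `p_c(ℤ³)`, almost surely":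

* `periodicFinRegion_induce_connected` — `ℤ³[S_M]` is connected (explicit lattice paths: every site
  is joined to the origin by at most three coordinate moves inside `S_M`, passing through the foot
  `(-1,0,0)` when it starts in the fin);
* `theta_eq_zero_of_mem_finPeriods` — for a good period `M ∈ finPeriods`, `θ_{ℤ³[S_M]}(x, p_c) = 0`
  for every `x ∈ S_M` (positivity of `θ` travels along paths,
  `RegionGluing.theta_pos_of_reachable_root`);
* `measure_iUnion_percolatesVia_eq_zero` — equivalently `P_{p_c}(some site of S_M lies in an
  infinite open cluster of ℤ³[S_M]) = 0`;
* `periodicFin_allRoots_of_lineRate` — under `SoloBlindOpenRungs.LineRate`, all of this holds for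
  every large period `M`.
-/

namespace Summit.CriticalPhenomena.PercolationContinuityZ3.Theorems

open MeasureTheory Filter Topology Literature.Probability.Percolation Literature.Probability.LatticeModels

/-! ### Coordinate moves inside an induced subgraph of `ℤ³` -/

/-- Moving coordinate `i` UP by `n` steps inside `S` joins the endpoints in `ℤ³[S]`. -/
theorem induce_reachable_update_add {S : Set (Site 3)} {x : Site 3} (hx : x ∈ S) (i : Fin 3)
    (n : ℕ) (h : ∀ m : ℕ, m ≤ n → Function.update x i (x i + m) ∈ S) :
    ((zdGraph 3).induce S).Reachable ⟨x, hx⟩ ⟨Function.update x i (x i + n), h n le_rfl⟩ := by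
  induction n with
  | zero =>
    have he : (⟨Function.update x i (x i + ((0 : ℕ) : ℤ)), h 0 le_rfl⟩ : S) = ⟨x, hx⟩ :=
      Subtype.ext (by simp)
    rw [he]
  | succ n ih =>
    have h' : ∀ m : ℕ, m ≤ n → Function.update x i (x i + m) ∈ S := fun m hm => h m (by omega)
    refine (ih h').trans (SimpleGraph.Adj.reachable ?_)
    rw [SimpleGraph.induce_adj]
    refine (zdGraph_adj_iff _ _).2 ⟨i, Or.inl ?_⟩
    funext j
    by_cases hj : j = i
    · subst hj; simp; ring
    · simp [hj]

/-- Moving coordinate `i` DOWN by `n` steps inside `S` joins the endpoints in `ℤ³[S]`. -/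
theorem induce_reachable_update_sub {S : Set (Site 3)} {x : Site 3} (hx : x ∈ S) (i : Fin 3)
    (n : ℕ) (h : ∀ m : ℕ, m ≤ n → Function.update x i (x i - m) ∈ S) :
    ((zdGraph 3).induce S).Reachable ⟨x, hx⟩ ⟨Function.update x i (x i - n), h n le_rfl⟩ := by
  induction n with
  | zero =>
    have he : (⟨Function.update x i (x i - ((0 : ℕ) : ℤ)), h 0 le_rfl⟩ : S) = ⟨x, hx⟩ :=
      Subtype.ext (by simp)
    rw [he]
  | succ n ih =>
    have h' : ∀ m : ℕ, m ≤ n → Function.update x i (x i - m) ∈ S := fun m hm => h m (by omega)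
    refine (ih h').trans (SimpleGraph.Adj.reachable ?_)
    rw [SimpleGraph.induce_adj]
    refine (zdGraph_adj_iff _ _).2 ⟨i, Or.inr ?_⟩
    funext j
    by_cases hj : j = i
    · subst hj; simp; ring
    · simp [hj]

/-- **Coordinate move.** If `update x i t ∈ S` for every `t` between `x i` and `b`, then `x` and
`update x i b` are joined in `ℤ³[S]`. -/
theorem induce_reachable_update {S : Set (Site 3)} {x : Site 3} (hx : x ∈ S) (i : Fin 3) (b : ℤ)
    (h : ∀ t ∈ Set.uIcc (x i) b, Function.update x i t ∈ S) (hb : Function.update x i b ∈ S) :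
    ((zdGraph 3).induce S).Reachable ⟨x, hx⟩ ⟨Function.update x i b, hb⟩ := by
  rcases le_or_gt (x i) b with hle | hgt
  · have hn : x i + ((b - x i).toNat : ℤ) = b := by rw [Int.toNat_of_nonneg (by omega)]; ring
    have h' : ∀ m : ℕ, m ≤ (b - x i).toNat → Function.update x i (x i + m) ∈ S := by
      intro m hm
      refine h _ ?_
      rw [Set.uIcc_of_le hle]
      have : (m : ℤ) ≤ ((b - x i).toNat : ℤ) := by exact_mod_cast hm
      rw [Int.toNat_of_nonneg (by omega)] at this
      exact ⟨by omega, by omega⟩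
    have he : (⟨Function.update x i (x i + ((b - x i).toNat : ℤ)), h' _ le_rfl⟩ : S) =
        ⟨Function.update x i b, hb⟩ := Subtype.ext (congrArg (Function.update x i) hn)
    rw [← he]
    exact induce_reachable_update_add hx i _ h'
  · have hn : x i - ((x i - b).toNat : ℤ) = b := by rw [Int.toNat_of_nonneg (by omega)]; ring
    have h' : ∀ m : ℕ, m ≤ (x i - b).toNat → Function.update x i (x i - m) ∈ S := by
      intro m hm
      refine h _ ?_
      rw [Set.uIcc_of_ge hgt.le]
      have : (m : ℤ) ≤ ((x i - b).toNat : ℤ) := by exact_mod_cast hm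
      rw [Int.toNat_of_nonneg (by omega)] at this
      exact ⟨by omega, by omega⟩
    have he : (⟨Function.update x i (x i - ((x i - b).toNat : ℤ)), h' _ le_rfl⟩ : S) =
        ⟨Function.update x i b, hb⟩ := Subtype.ext (congrArg (Function.update x i) hn)
    rw [← he]
    exact induce_reachable_update_sub hx i _ h'

/-! ### `ℤ³[S_M]` is connected -/

/-- From a site of the half-space to the origin inside `S_M`: coordinate 2, then 1, then 0, to zero. -/
theorem reachable_zero_of_nonneg (M : ℕ) {x : Site 3} (hx0 : 0 ≤ x 0)
    (hx : x ∈ periodicFinRegion M) :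
    ((zdGraph 3).induce (periodicFinRegion M)).Reachable ⟨x, hx⟩
      ⟨0, zero_mem_periodicFinRegion M⟩ := by
  -- coordinate 2 to 0
  have h1 : ∀ t ∈ Set.uIcc (x 2) 0, Function.update x 2 t ∈ periodicFinRegion M :=
    fun t _ => Or.inl (by simpa using hx0)
  have hy := h1 0 Set.right_mem_uIcc
  have r1 := induce_reachable_update hx 2 0 h1 hy
  -- coordinate 1 to 0
  have h2 : ∀ t ∈ Set.uIcc (Function.update x 2 (0 : ℤ) 1) 0,
      Function.update (Function.update x 2 (0 : ℤ)) 1 t ∈ periodicFinRegion M :=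
    fun t _ => Or.inl (by simpa using hx0)
  have hz := h2 0 Set.right_mem_uIcc
  have r2 := induce_reachable_update hy 1 0 h2 hz
  -- coordinate 0 down to 0
  have h3 : ∀ t ∈ Set.uIcc (Function.update (Function.update x 2 (0 : ℤ)) 1 (0 : ℤ) 0) 0,
      Function.update (Function.update (Function.update x 2 (0 : ℤ)) 1 (0 : ℤ)) 0 t ∈
        periodicFinRegion M := by
    intro t ht
    have e0 : Function.update (Function.update x 2 (0 : ℤ)) 1 (0 : ℤ) 0 = x 0 := by simp
    rw [e0, Set.uIcc_of_ge hx0] at ht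
    exact Or.inl (by simpa using ht.1)
  have hw := h3 0 Set.right_mem_uIcc
  have r3 := induce_reachable_update hz 0 0 h3 hw
  have hend : (⟨_, hw⟩ : periodicFinRegion M) = ⟨0, zero_mem_periodicFinRegion M⟩ := by
    refine Subtype.ext ?_
    funext j
    fin_cases j <;> simp
  rw [hend] at r3
  exact (r1.trans r2).trans r3

/-- From a site of the fin to the origin inside `S_M`: coordinate 2 to zero inside the fin, then
coordinate 0 up to zero — through the fin (`t ≤ -2`), the foot `(-1,0,0)` (`M ∣ 0`) and into `ℍ`. -/
theorem reachable_zero_of_fin (M : ℕ) {x : Site 3} (hx1 : x 1 = 0) (hx0 : x 0 ≤ -2)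
    (hx : x ∈ periodicFinRegion M) :
    ((zdGraph 3).induce (periodicFinRegion M)).Reachable ⟨x, hx⟩
      ⟨0, zero_mem_periodicFinRegion M⟩ := by
  have h1 : ∀ t ∈ Set.uIcc (x 2) 0, Function.update x 2 t ∈ periodicFinRegion M :=
    fun t _ => Or.inr (Or.inl ⟨by simpa using hx1, by simpa using hx0⟩)
  have hy := h1 0 Set.right_mem_uIcc
  have r1 := induce_reachable_update hx 2 0 h1 hy
  have h2 : ∀ t ∈ Set.uIcc (Function.update x 2 (0 : ℤ) 0) 0,
      Function.update (Function.update x 2 (0 : ℤ)) 0 t ∈ periodicFinRegion M := by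
    intro t ht
    have e0 : Function.update x 2 (0 : ℤ) 0 = x 0 := by simp
    rw [e0, Set.uIcc_of_le (by omega : x 0 ≤ 0)] at ht
    rcases lt_trichotomy t (-1) with hlt | heq | hgt
    · exact Or.inr (Or.inl ⟨by simpa using hx1, by simpa using (by omega : t ≤ -2)⟩)
    · exact Or.inr (Or.inr ⟨by simpa using hx1, by simpa using heq, by simp⟩)
    · exact Or.inl (by simpa using (by omega : 0 ≤ t))
  have hz := h2 0 Set.right_mem_uIcc
  have r2 := induce_reachable_update hy 0 0 h2 hz
  have hend : (⟨_, hz⟩ : periodicFinRegion M) = ⟨0, zero_mem_periodicFinRegion M⟩ := by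
    refine Subtype.ext ?_
    funext j
    fin_cases j <;> simp [hx1]
  rw [hend] at r2
  exact r1.trans r2

/-- From a foot to the origin inside `S_M`: one step up into `ℍ`, then `reachable_zero_of_nonneg`. -/
theorem reachable_zero_of_foot (M : ℕ) {x : Site 3} (hx0 : x 0 = -1)
    (hx : x ∈ periodicFinRegion M) :
    ((zdGraph 3).induce (periodicFinRegion M)).Reachable ⟨x, hx⟩
      ⟨0, zero_mem_periodicFinRegion M⟩ := by
  have h1 : ∀ t ∈ Set.uIcc (x 0) 0, Function.update x 0 t ∈ periodicFinRegion M := by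
    intro t ht
    rw [hx0, Set.uIcc_of_le (by norm_num : (-1 : ℤ) ≤ 0)] at ht
    rcases eq_or_lt_of_le ht.1 with h | h
    · have hxt : Function.update x 0 t = x := by
        rw [← h, ← hx0]; exact Function.update_eq_self 0 x
      rw [hxt]; exact hx
    · exact Or.inl (by simpa using (by omega : 0 ≤ t))
  have hy := h1 0 Set.right_mem_uIcc
  exact (induce_reachable_update hx 0 0 h1 hy).trans (reachable_zero_of_nonneg M (by simp) hy)

/-- Every site of `S_M` is joined to the origin inside `ℤ³[S_M]`. -/
theorem reachable_zero (M : ℕ) (x : Site 3) (hx : x ∈ periodicFinRegion M) :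
    ((zdGraph 3).induce (periodicFinRegion M)).Reachable ⟨x, hx⟩
      ⟨0, zero_mem_periodicFinRegion M⟩ := by
  rcases hx with h | ⟨h1, h0⟩ | ⟨-, h0, -⟩
  · exact reachable_zero_of_nonneg M h _
  · exact reachable_zero_of_fin M h1 h0 _
  · exact reachable_zero_of_foot M h0 _

/-- **`ℤ³[S_M]` is connected** (for every `M`, including `M = 0`: the single foot `(-1,0,0)`). -/
theorem periodicFinRegion_induce_connected (M : ℕ) :
    ((zdGraph 3).induce (periodicFinRegion M)).Connected :=
  { preconnected := fun a b => (reachable_zero M a.1 a.2).trans (reachable_zero M b.1 b.2).symm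
    nonempty := ⟨⟨0, zero_mem_periodicFinRegion M⟩⟩ }

/-! ### All roots -/

/-- **All roots.** For a good period `M ∈ finPeriods`, `θ_{ℤ³[S_M]}(x, p_c(ℤ³)) = 0` at EVERY
`x ∈ S_M` (positivity of `θ` is inherited along paths of the connected graph `ℤ³[S_M]`). -/
theorem theta_eq_zero_of_mem_finPeriods {M : ℕ} (hM : M ∈ finPeriods) (x : Site 3)
    (hx : x ∈ periodicFinRegion M) :
    theta ((zdGraph 3).induce (periodicFinRegion M)) ⟨x, hx⟩ (criticalProbI 3) = 0 := by
  by_contra hne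
  have hpos : 0 < theta ((zdGraph 3).induce (periodicFinRegion M)) ⟨x, hx⟩ (criticalProbI 3) :=
    lt_of_le_of_ne measureReal_nonneg (Ne.symm hne)
  have h0 := RegionGluing.theta_pos_of_reachable_root _ (reachable_zero M x hx).symm _ hpos
  exact h0.ne' ((mem_finPeriods_iff M).1 hM)

/-- `M ∈ finPeriods` iff `θ_{ℤ³[S_M]}(·, p_c)` vanishes at every root. -/
theorem mem_finPeriods_iff_forall (M : ℕ) :
    M ∈ finPeriods ↔ ∀ (x : Site 3) (hx : x ∈ periodicFinRegion M),
      theta ((zdGraph 3).induce (periodicFinRegion M)) ⟨x, hx⟩ (criticalProbI 3) = 0 :=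
  ⟨fun h x hx => theta_eq_zero_of_mem_finPeriods h x hx, fun h h0 => h 0 h0⟩

/-- **No infinite cluster at all.** For `M ∈ finPeriods`, `P_{p_c}`-almost surely no site of `S_M`
lies in an infinite open cluster of `ℤ³[S_M]` (countable union of the null events `{x ↔ ∞ in S_M}`). -/
theorem measure_iUnion_percolatesVia_eq_zero {M : ℕ} (hM : M ∈ finPeriods) :
    bondPercolation (zdGraph 3) (criticalProbI 3)
      (⋃ x ∈ periodicFinRegion M,
        percolatesVia (withinGraph (zdGraph 3) (periodicFinRegion M)) x) = 0 := by
  refine (measure_biUnion_null_iff (Set.to_countable _)).2 fun x hx => ?_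
  have h := theta_eq_zero_of_mem_finPeriods hM x hx
  rwa [theta_induce_eq_real_percolatesVia, measureReal_eq_zero_iff (measure_ne_top _ _)] at h

/-- **Periodic fins under `LineRate`, every root.** If `Σ_z P_{p_c}(0 ↔ (0,0,z) in ℍ) < ∞` then for
all large periods `M`, `θ_{ℤ³[S_M]}(x, p_c(ℤ³)) = 0` for every `x ∈ S_M`. -/
theorem periodicFin_allRoots_of_lineRate (hL : SoloBlindOpenRungs.LineRate) :
    ∃ M₀ : ℕ, ∀ M : ℕ, M₀ ≤ M → ∀ (x : Site 3) (hx : x ∈ periodicFinRegion M),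
      theta ((zdGraph 3).induce (periodicFinRegion M)) ⟨x, hx⟩ (criticalProbI 3) = 0 := by
  obtain ⟨M₀, hM₀⟩ := eventually_atTop.1 (eventually_mem_finPeriods_of_lineRate hL)
  exact ⟨M₀, fun M hM x hx => theta_eq_zero_of_mem_finPeriods (hM₀ M hM) x hx⟩

/-- **Periodic fins under `LineRate`, no infinite cluster.** For all large `M`, `P_{p_c}`-a.s. the
graph `ℤ³[S_M]` has no infinite open cluster. -/
theorem periodicFin_noInfiniteCluster_of_lineRate (hL : SoloBlindOpenRungs.LineRate) :
    ∃ M₀ : ℕ, ∀ M : ℕ, M₀ ≤ M →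
      bondPercolation (zdGraph 3) (criticalProbI 3)
        (⋃ x ∈ periodicFinRegion M,
          percolatesVia (withinGraph (zdGraph 3) (periodicFinRegion M)) x) = 0 := by
  obtain ⟨M₀, hM₀⟩ := eventually_atTop.1 (eventually_mem_finPeriods_of_lineRate hL)
  exact ⟨M₀, fun M hM => measure_iUnion_percolatesVia_eq_zero (hM₀ M hM)⟩

end Summit.CriticalPhenomena.PercolationContinuityZ3.Theorems
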